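import Summits.ResolutionOfSingularities.ResolutionOfSingularities.Theses.PAlteration
import Literature.AlgebraicGeometry.Resolution.RegularLocalRingsNormal
import Literature.AlgebraicGeometry.Resolution.ProjectiveSpaceRegular

/-!
# `PalterationThesis` — negative lemmas IV: PICover has content at every prime (its conclusion
# cannot be strengthened to "the cover is regular")

Support (negative) lemmas for crux `stmt-ResolutionOfSingularities-0552`
(`Summit.ResolutionOfSingularities.ResolutionOfSingularities.Theses.PAlteration.PalterationThesis`
= `∀ p prime, PIAlt_p ∧ PICover_p`), second conjunct PICover (= route item `Picover`,
stmt-0554), filed by the standing disprover (cdisprove gen 1; work file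
`Cruxes/PalterationThesis/Disproof.lean` §5; companions `LoadBearing.lean`, `PicoverFiniteLoadBearing.lean`; the sibling crux work file
`Cruxes/Picover/Disproof.lean` §4 records this strengthening on paper only). This file declares
NO definition:
the witness is written out as `Algebra.adjoin 𝔽_p {T^p, T^{p+1}} ⊆ 𝔽_p[T]` with the structure
map `Polynomial.aeval ⟨T^p, _⟩ : 𝔽_p[s] → 𝔽_p[T^p, T^{p+1}]`.

* `hcusp_*`, `not_isRegular_spec_hcusp` — for any field `K` and `n ≥ 2`, the higher cusp
  `Spec K[Tⁿ, Tⁿ⁺¹]` is not regular (`T = Tⁿ⁺¹/Tⁿ` is integral and not in the ring, so the ring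
  is not integrally closed; a regular local ring is integrally closed — Matsumura 19.4,
  `isIntegrallyClosed_of_isRegularLocalRing` in the tree — and integral closedness is local,
  `IsIntegrallyClosed.of_localization_maximal`). Generalises the tree's `not_isRegular_spec_cusp`
  (`n = 2`, `Theorems/WeightedThesis/Negative/LoadBearing.lean`).
* `coe_hcuspMap`, `hcusp_pow_p_eq` — `s ↦ T^p` is `expand p` on polynomials, and `a^p` is the
  image of the polynomial `a` (over `𝔽_p`, `expand p a = a^p`).
* `universallyInjective_hcuspCover`, `isFinite_hcuspCover`, `surjective_hcuspCover` — the cover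
  `Spec 𝔽_p[T^p, T^{p+1}] → 𝔸¹_{𝔽_p}` is universally injective (`K`-points criterion
  `tfae_universallyInjective` + injectivity of Frobenius on fields), finite (integral and of
  finite type, `RingHom.IsIntegral.to_finite`) and surjective (lying over,
  `RingHom.IsIntegral.comap_surjective`).
* `picover_strengthening_isRegular_false` — hence **at every prime the hypotheses of PICover have
  a non-degenerate inhabitant whose source is SINGULAR**: the conclusion `Scheme.HasResolution X`
  cannot be strengthened to `Scheme.IsRegular X`; PICover has content already in dimension one
  (where it is settled by normalisation / `CossartPiltant2019`).

## Sources
* H. Matsumura, *Commutative Ring Theory*, CUP 1986, Thm. 19.4 (regular local ⇒ normal).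
* The Stacks Project, Tag 01S4 (radicial morphisms; `K`-points criterion), Tag 00FZ (lying
  over). Folklore (the cusp `T^p = s`, `T^{p+1}`; purely inseparable covers of the line).
-/

noncomputable section

open CategoryTheory AlgebraicGeometry TopologicalSpace Topology
open Literature.AlgebraicGeometry.Resolution
open Summit.ResolutionOfSingularities.ResolutionOfSingularities.Theses.PAlteration

set_option linter.dupNamespace false

namespace Summit.ResolutionOfSingularities.ResolutionOfSingularities.Theorems.PalterationThesis.Negative

section Cusp

open Polynomial

variable (K : Type) [Field K] (n : ℕ)

/-- Elements of the higher cusp algebra `K[Tⁿ, Tⁿ⁺¹] = Algebra.adjoin K {Tⁿ, Tⁿ⁺¹} ⊆ K[T]`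
(`n ≥ 2`) have no linear term. [folklore] -/
theorem hcusp_coeff_one_eq_zero (hn : 2 ≤ n) {s : K[X]}
    (hs : s ∈ Algebra.adjoin K ({X ^ n, X ^ (n + 1)} : Set K[X])) : s.coeff 1 = 0 := by
  refine Algebra.adjoin_induction (p := fun s _ => s.coeff 1 = 0) ?_ ?_ ?_ ?_ hs
  · intro x hx
    simp only [Set.mem_insert_iff, Set.mem_singleton_iff] at hx
    rcases hx with hx | hx <;> rw [hx, Polynomial.coeff_X_pow] <;> simp <;> omega
  · intro r
    show (algebraMap K K[X] r).coeff 1 = 0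
    rw [Polynomial.algebraMap_apply, Polynomial.coeff_C]
    simp
  · intro x y _ _ hx hy
    simp [hx, hy]
  · intro x y _ _ hx hy
    simp [Polynomial.coeff_mul, Finset.Nat.sum_antidiagonal_succ, hx, hy]

/-- `T ∉ K[Tⁿ, Tⁿ⁺¹]` for `n ≥ 2`. [folklore] -/
theorem hcusp_X_not_mem (hn : 2 ≤ n) :
    (X : K[X]) ∉ Algebra.adjoin K ({X ^ n, X ^ (n + 1)} : Set K[X]) := fun h => by
  simpa using hcusp_coeff_one_eq_zero K n hn h

/-- `K[Tⁿ, Tⁿ⁺¹]` (`n ≥ 2`) is not integrally closed: `T = Tⁿ⁺¹/Tⁿ` satisfies `Tⁿ ∈ K[Tⁿ, Tⁿ⁺¹]`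
but `T ∉ K[Tⁿ, Tⁿ⁺¹]`. [folklore] -/
theorem hcusp_not_isIntegrallyClosed (hn : 2 ≤ n) :
    ¬ IsIntegrallyClosed ↥(Algebra.adjoin K ({X ^ n, X ^ (n + 1)} : Set K[X])) := by
  intro h
  set A : Subalgebra K K[X] := Algebra.adjoin K ({X ^ n, X ^ (n + 1)} : Set K[X]) with hA
  have hmem_n : (X ^ n : K[X]) ∈ A := Algebra.subset_adjoin (by simp)
  have hmem_n1 : (X ^ (n + 1) : K[X]) ∈ A := Algebra.subset_adjoin (by simp)
  let a : A := ⟨X ^ n, hmem_n⟩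
  let b : A := ⟨X ^ (n + 1), hmem_n1⟩
  have ha : a ≠ 0 := by
    intro h0
    have := congrArg Subtype.val h0
    simp [a] at this
  let L := FractionRing A
  have haL : algebraMap A L a ≠ 0 := fun h0 =>
    ha ((IsFractionRing.injective A L) (h0.trans (map_zero _).symm))
  let x : L := algebraMap A L b / algebraMap A L a
  have hxn : x ^ n = algebraMap A L a := by
    rw [div_pow, div_eq_iff (pow_ne_zero n haL), ← map_pow, ← map_pow, ← map_mul]
    congr 1
    apply Subtype.ext
    simp [a, b]
    ring
  obtain ⟨y, hy⟩ := IsIntegrallyClosed.exists_algebraMap_eq_of_isIntegral_pow (R := A) (K := L)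
    (by omega : 0 < n) (hxn ▸ isIntegral_algebraMap)
  have hy' : algebraMap A L (y * a) = algebraMap A L b := by
    rw [map_mul, hy, div_mul_cancel₀ _ haL]
  have hy'' : y * a = b := IsFractionRing.injective A L hy'
  have hval : (y : K[X]) * X ^ n = X ^ (n + 1) := by
    have := congrArg Subtype.val hy''
    simpa [a, b] using this
  have hyX : (y : K[X]) = X := by
    have hXn : (X ^ n : K[X]) ≠ 0 := pow_ne_zero n X_ne_zero
    apply mul_right_cancel₀ hXn
    rw [hval]; ring
  have hXA : (X : K[X]) ∈ A := by rw [← hyX]; exact y.2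
  exact hcusp_X_not_mem K n hn hXA

/-- Some maximal ideal of `K[Tⁿ, Tⁿ⁺¹]` has a NON-regular local ring (else every localisation
would be integrally closed — `isIntegrallyClosed_of_isRegularLocalRing`, Matsumura 19.4 — hence
so would the ring, `IsIntegrallyClosed.of_localization_maximal`). [folklore] -/
theorem hcusp_exists_not_isRegularLocalRing (hn : 2 ≤ n) :
    ∃ (m : Ideal ↥(Algebra.adjoin K ({X ^ n, X ^ (n + 1)} : Set K[X]))) (_ : m.IsMaximal),
      ¬ IsRegularLocalRing (Localization.AtPrime m) := by
  by_contra hall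
  simp only [not_exists, not_not] at hall
  refine hcusp_not_isIntegrallyClosed K n hn
    (IsIntegrallyClosed.of_localization_maximal fun m _ hm => ?_)
  haveI := hall m hm
  exact isIntegrallyClosed_of_isRegularLocalRing _

/-- **The higher cusp `Spec K[Tⁿ, Tⁿ⁺¹]` (`n ≥ 2`) is not a regular scheme.** [folklore] -/
theorem not_isRegular_spec_hcusp (hn : 2 ≤ n) :
    ¬ Scheme.IsRegular (Spec (.of ↥(Algebra.adjoin K ({X ^ n, X ^ (n + 1)} : Set K[X])))) := by
  intro h
  obtain ⟨m, hm, hreg⟩ := hcusp_exists_not_isRegularLocalRing K n hn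
  let x : PrimeSpectrum ↥(Algebra.adjoin K ({X ^ n, X ^ (n + 1)} : Set K[X])) := ⟨m, hm.isPrime⟩
  haveI := h x
  exact hreg (IsRegularLocalRing.of_ringEquiv
    (Spec.stalkIso (.of ↥(Algebra.adjoin K ({X ^ n, X ^ (n + 1)} : Set K[X]))) x).commRingCatIsoToRingEquiv)

end Cusp

section CuspCover

open Polynomial

variable (p : ℕ) [hp : Fact p.Prime]

/-- The structure map `𝔽_p[s] → 𝔽_p[T^p, T^{p+1}]`, `s ↦ T^p`, as a ring homomorphism. -/
theorem X_pow_mem_hcusp (K : Type) [Field K] (n : ℕ) :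
    (X ^ n : K[X]) ∈ Algebra.adjoin K ({X ^ n, X ^ (n + 1)} : Set K[X]) :=
  Algebra.subset_adjoin (by simp)

/-- Over `𝔽_p`, `expand p f = f ^ p`. [folklore] -/
theorem expand_eq_pow_zmod (f : (ZMod p)[X]) : expand (ZMod p) p f = f ^ p := by
  have h := Polynomial.map_frobenius_expand p f
  rwa [ZMod.frobenius_zmod, Polynomial.map_id] at h

/-- The map `𝔽_p[s] → 𝔽_p[T^p, T^{p+1}] ⊆ 𝔽_p[T]`, `s ↦ T^p`, is `expand p` on underlying
polynomials. [folklore] -/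
theorem coe_hcuspMap (q : (ZMod p)[X]) :
    ((Polynomial.aeval (R := ZMod p)
      (⟨X ^ p, X_pow_mem_hcusp (ZMod p) p⟩ :
        ↥(Algebra.adjoin (ZMod p) ({X ^ p, X ^ (p + 1)} : Set (ZMod p)[X]))) q :
        ↥(Algebra.adjoin (ZMod p) ({X ^ p, X ^ (p + 1)} : Set (ZMod p)[X]))) : (ZMod p)[X]) =
      expand (ZMod p) p q := by
  change (Algebra.adjoin (ZMod p) ({X ^ p, X ^ (p + 1)} : Set (ZMod p)[X])).val
      (Polynomial.aeval (R := ZMod p) _ q) = _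
  rw [← Polynomial.aeval_algHom_apply, Polynomial.coe_expand, Polynomial.aeval_def,
    Polynomial.algebraMap_eq]
  rfl

/-- For `a ∈ 𝔽_p[T^p, T^{p+1}] ⊆ 𝔽_p[T]`: `a ^ p` is the image of the polynomial `a` under
`s ↦ T^p` (over `𝔽_p`, `expand p a = a ^ p`). [folklore] -/
theorem hcusp_pow_p_eq (a : ↥(Algebra.adjoin (ZMod p) ({X ^ p, X ^ (p + 1)} : Set (ZMod p)[X]))) :
    a ^ p = Polynomial.aeval (R := ZMod p)
      (⟨X ^ p, X_pow_mem_hcusp (ZMod p) p⟩ :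
        ↥(Algebra.adjoin (ZMod p) ({X ^ p, X ^ (p + 1)} : Set (ZMod p)[X]))) (a : (ZMod p)[X]) := by
  apply Subtype.ext
  rw [SubmonoidClass.coe_pow, coe_hcuspMap, expand_eq_pow_zmod]

/-- **The radicial finite cover `Spec 𝔽_p[T^p, T^{p+1}] → 𝔸¹ = Spec 𝔽_p[s]` (`s ↦ T^p`) is
universally injective**: two ring maps to a field agreeing on `𝔽_p[T^p]` agree on `a`, since they
agree on `a^p ∈ 𝔽_p[T^p]` and Frobenius is injective on fields of characteristic `p`. [folklore] -/
theorem universallyInjective_hcuspCover :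
    UniversallyInjective (Spec.map (CommRingCat.ofHom (Polynomial.aeval (R := ZMod p)
      (⟨X ^ p, X_pow_mem_hcusp (ZMod p) p⟩ :
        ↥(Algebra.adjoin (ZMod p) ({X ^ p, X ^ (p + 1)} : Set (ZMod p)[X])))).toRingHom)) := by
  refine ((tfae_universallyInjective _).out 0 1).mpr ?_
  intro K _ g₁ g₂ h
  obtain ⟨φ₁, rfl⟩ := Spec.map_surjective g₁
  obtain ⟨φ₂, rfl⟩ := Spec.map_surjective g₂
  simp only [← Spec.map_comp] at h
  have h' := congrArg (fun ψ => ψ.hom) (Spec.map_injective h)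
  simp only [CommRingCat.hom_comp, CommRingCat.hom_ofHom] at h'
  haveI : CharP K p := by
    have ψ : ZMod p →+* K := φ₁.hom.comp (algebraMap (ZMod p) _)
    exact (ψ.charP_iff_charP p).mp inferInstance
  congr 1
  ext1
  refine RingHom.ext fun a => ?_
  have key : (φ₁.hom a) ^ p = (φ₂.hom a) ^ p := by
    rw [← map_pow, ← map_pow, hcusp_pow_p_eq]
    exact congrFun (congrArg DFunLike.coe h') (a : (ZMod p)[X])
  exact (frobenius K p).injective (by simpa only [frobenius_def] using key)

/-- The cover is finite: `𝔽_p[T^p, T^{p+1}]` is integral (`a^p ∈ 𝔽_p[T^p]`) and of finite type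
over `𝔽_p[s]`. [folklore] -/
theorem isFinite_hcuspCover :
    IsFinite (Spec.map (CommRingCat.ofHom (Polynomial.aeval (R := ZMod p)
      (⟨X ^ p, X_pow_mem_hcusp (ZMod p) p⟩ :
        ↥(Algebra.adjoin (ZMod p) ({X ^ p, X ^ (p + 1)} : Set (ZMod p)[X])))).toRingHom)) := by
  rw [IsFinite.SpecMap_iff]
  set ψ := (Polynomial.aeval (R := ZMod p)
      (⟨X ^ p, X_pow_mem_hcusp (ZMod p) p⟩ :
        ↥(Algebra.adjoin (ZMod p) ({X ^ p, X ^ (p + 1)} : Set (ZMod p)[X])))).toRingHom with hψ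
  show ψ.Finite
  have hft : ψ.FiniteType := by
    refine RingHom.FiniteType.of_comp_finiteType (f := Polynomial.C) ?_
    have : ψ.comp Polynomial.C = algebraMap (ZMod p) _ := by
      ext r
      simp [hψ]
    rw [this]
    refine RingHom.finiteType_algebraMap.mpr ⟨(Subalgebra.fg_top _).mpr ⟨{X ^ p, X ^ (p + 1)}, ?_⟩⟩
    simp
  have hint : ψ.IsIntegral := by
    intro a
    refine ⟨Polynomial.X ^ p - Polynomial.C (a : (ZMod p)[X]), Polynomial.monic_X_pow_sub_C _ hp.out.ne_zero, ?_⟩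
    rw [eval₂_sub, eval₂_X_pow, eval₂_C, hcusp_pow_p_eq, sub_eq_zero]
    rfl
  exact hint.to_finite hft

/-- The cover is surjective (finite with injective ring map: lying over). [folklore] -/
theorem surjective_hcuspCover :
    Function.Surjective (Spec.map (CommRingCat.ofHom (Polynomial.aeval (R := ZMod p)
      (⟨X ^ p, X_pow_mem_hcusp (ZMod p) p⟩ :
        ↥(Algebra.adjoin (ZMod p) ({X ^ p, X ^ (p + 1)} : Set (ZMod p)[X])))).toRingHom)).base := by
  set ψ := (Polynomial.aeval (R := ZMod p)
      (⟨X ^ p, X_pow_mem_hcusp (ZMod p) p⟩ :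
        ↥(Algebra.adjoin (ZMod p) ({X ^ p, X ^ (p + 1)} : Set (ZMod p)[X])))).toRingHom with hψ
  have hinj : Function.Injective ψ := by
    intro f g hfg
    have := congrArg Subtype.val hfg
    rw [hψ] at this
    change ((Polynomial.aeval (R := ZMod p) _ f : ↥(Algebra.adjoin (ZMod p)
        ({X ^ p, X ^ (p + 1)} : Set (ZMod p)[X]))) : (ZMod p)[X]) =
      ((Polynomial.aeval (R := ZMod p) _ g : ↥(Algebra.adjoin (ZMod p)
        ({X ^ p, X ^ (p + 1)} : Set (ZMod p)[X]))) : (ZMod p)[X]) at this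
    rw [coe_hcuspMap, coe_hcuspMap] at this
    exact Polynomial.expand_injective hp.out.pos this
  have hint : ψ.IsIntegral := by
    intro a
    refine ⟨Polynomial.X ^ p - Polynomial.C (a : (ZMod p)[X]), Polynomial.monic_X_pow_sub_C _ hp.out.ne_zero, ?_⟩
    rw [eval₂_sub, eval₂_X_pow, eval₂_C, hcusp_pow_p_eq, sub_eq_zero]
    rfl
  intro y
  obtain ⟨x, hx⟩ := hint.comap_surjective hinj y
  exact ⟨x, hx⟩

/-- **PICover has content at every prime already for curves: the conclusion `HasResolution X`
cannot be strengthened to `Scheme.IsRegular X`.** Witness: the radicial finite cover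
`Spec 𝔽_p[T^p, T^{p+1}] → 𝔸¹_{𝔽_p}` (finite, universally injective, surjective, integral
source and regular integral base of finite type over `𝔽_p`) has a SINGULAR source
(`not_isRegular_spec_hcusp`). This is also a non-degenerate inhabitant of the hypotheses of
PICover (where the conclusion holds by normalisation / `CossartPiltant2019`). [folklore] -/
theorem picover_strengthening_isRegular_false :
    ¬ ∀ (k : Type) [Field k] [CharP k p] (Y X : Scheme.{0}) (f : Y ⟶ Spec (.of k)) (g : X ⟶ Y),
        IsSeparated f → LocallyOfFiniteType f → QuasiCompact f → IsIntegral Y →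
          Scheme.IsRegular Y → IsIntegral X → IsFinite g → UniversallyInjective g →
            Function.Surjective g.base → Scheme.IsRegular X := by
  intro h
  let f : Spec (.of (ZMod p)[X]) ⟶ Spec (.of (ZMod p)) :=
    Spec.map (CommRingCat.ofHom (algebraMap (ZMod p) (ZMod p)[X]))
  haveI : LocallyOfFiniteType f :=
    (HasRingHomProperty.Spec_iff (P := @LocallyOfFiniteType)).mpr
      (RingHom.finiteType_algebraMap.mpr inferInstance)
  exact not_isRegular_spec_hcusp (ZMod p) p hp.out.two_le
    (h (ZMod p) (Spec (.of (ZMod p)[X])) _ f _ inferInstance inferInstance inferInstance inferInstance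
      (Scheme.isRegular_Spec (.of (ZMod p)[X])) inferInstance (isFinite_hcuspCover p)
      (universallyInjective_hcuspCover p) (surjective_hcuspCover p))

end CuspCover

/-- **The crux-level strengthening is false**: it is not the case that for every prime `p` every
integral finite radicial cover of a regular integral separated scheme of finite type over a field
of characteristic `p` is regular (already `p = 2` fails). [folklore] -/
theorem palterationThesis_strengthening_isRegular_false :
    ¬ ∀ p : ℕ, p.Prime → ∀ (k : Type) [Field k] [CharP k p] (Y X : Scheme.{0})
        (f : Y ⟶ Spec (.of k)) (g : X ⟶ Y), IsSeparated f → LocallyOfFiniteType f →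
          QuasiCompact f → IsIntegral Y → Scheme.IsRegular Y → IsIntegral X → IsFinite g →
            UniversallyInjective g → Function.Surjective g.base → Scheme.IsRegular X :=
  fun h =>
  haveI : Fact (Nat.Prime 2) := ⟨Nat.prime_two⟩
  picover_strengthening_isRegular_false 2 (h 2 Nat.prime_two)

end Summit.ResolutionOfSingularities.ResolutionOfSingularities.Theorems.PalterationThesis.Negative

end
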